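import Mathlib.RingTheory.MvPolynomial.Symmetric.Defs
import Literature.Computability.AlgebraicComplexity.ObstructionTypes
import HarnessLib

/-!
# Dutta–Gesmundo–Ikenmeyer–Jindal–Lysikov: multiplicity obstructions for the power sum versus
# product-plus-power `x₁ ⋯ x_d + x₀^d`

Topic `Literature/Computability/AlgebraicComplexity`. Named fact (D-0014) vendoring the "new
obstructions" theorem of P. Dutta, F. Gesmundo, C. Ikenmeyer, G. Jindal, V. Lysikov, *Geometric
complexity theory for product-plus-power*, J. Symbolic Comput. (2025) 102458 = arXiv:2211.07055
(locators are those of the arXiv version), in the tree's vocabulary: forms of degree `d` in the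
`d + 1` variables `Fin (d + 1)` (`x₀ = X 0`, `x_i = X i`), `G = GL_{d+1}`; the product-plus-power
polynomial `P^{[d]}_{1,1} = ∏_{i ∈ [d]} x_i + x₀^d` (§1, p. 5) is `productPlusPower ℂ d`, the power
sum `x₀^d + ⋯ + x_d^d` is Mathlib's `MvPolynomial.psum (Fin (d+1)) ℂ d`; `mult_λ(ℂ[\overline{GL_n f}]_D)`
(§1, p. 5: "the representation theoretic multiplicity `mult_λ` counts the number of irreducible
representations of type `λ`" in `ℂ[\overline{GL_n f}]_D`, a quotient of `ℂ[ℂ[x₁,…,x_n]_d]_D`) is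
`orbitMultiplicity ℂ f d (Weight.dualOfPartition (d+1) λ)`, the dual-weight convention of
`SchurWeylPlethysm.lean` / `Complexity.partitionWeightLex` under which the plethysm coefficient
of `λ` sits at the weight `Weight.dualOfPartition _ λ` (the weight pins `D = |λ|/d`).

WHAT IS REPRODUCED (verbatim):

* Thm. 4.10 (p. 24) [`DGIJL2025_thm_4_10`]: "Let `d ≥ 3` be even, and let
  `λ := (5d-1,1)+((d+1) × (10d))`. Then we have representation theoretic multiplicity
  obstructions: `mult_λ(ℂ[\overline{GL_{d+1} P^{[d]}_{1,1}}]) ≤ 4 < 5 =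
  mult_λ(ℂ[\overline{GL_{d+1} (x₁^d + ⋯ + x_{d+1}^d)}])`, and hence
  `\overline{GL_{d+1} (x₁^d + ⋯ + x_{d+1}^d)} ⊄ \overline{GL_{d+1} P^{[d]}_{1,1}}`."
  (`λ = (15d-1, 10d+1, 10d, …, 10d)`, `d + 1` parts, `λ ⊢ 10d² + 15d`: `dgijlPartition d _`.)
  DIVERGENCE (recorded, not adjudicated): the introduction's Thm. 1.4 (p. 5) states the same
  display for "`d ≥ 3`" without "even" ("These `λ` are representation theoretic multiplicity
  obstructions that show `x₀^d + ⋯ + x_d^d ⋬ P^{[d]}_{1,1}`"), while the body's Thm. 4.10, of which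
  Thm. 1.4 is said to be "a restatement", assumes `d` even; the fact below is the body version.

WHAT IS PROVED HERE (kernel): `λ` is a multiplicity obstruction against
`x₀^d + ⋯ + x_d^d ∈ Δ_d[P^{[d]}_{1,1}]` (`dgijl2025_isMultiplicityObstructionAt`) and hence the
separation `x₀^d + ⋯ + x_d^d ∉ Δ_d[P^{[d]}_{1,1}]` by the multiplicity-obstruction principle
(`dgijl2025_psum_not_mem_orbitClosure`).

NOT here: whether these `λ` are occurrence / vanishing-ideal occurrence obstructions (the paper
does not decide it), Props. 4.11–4.12 (the two bounds separately), the Kronecker-power results.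

## References

* P. Dutta, F. Gesmundo, C. Ikenmeyer, G. Jindal, V. Lysikov, *Geometric complexity theory for
  product-plus-power*, J. Symbolic Comput. (2025) 102458; arXiv:2211.07055, §1 (Thm. 1.4), §4.3
  (Thm. 4.10). [DuttaGesmundoIkenmeyerJindalLysikovJSC2025]
* C. Ikenmeyer, U. Kandasamy, STOC 2020, arXiv:1911.03990 (the symmetry method).
  [IkenmeyerKandasamy2019]

Provenance: pub-gct census cell, LEAN-IN-TREE import of the typed census (toy-model rung
"multiplicity obstructions from symmetries, product-plus-power"); PDF pages of arXiv:2211.07055.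
-/

noncomputable section

open MvPolynomial

namespace Literature.Computability.AlgebraicComplexity

open _root_.Literature.NumberTheory.DiophantineGeometry

variable (k : Type*) [Field k]

/-- The product-plus-power polynomial `P^{[d]}_{1,1} = ∏_{i ∈ [d]} x_i + x₀^d` in the variables
`x₀, …, x_d` (DGIJL §1, p. 5: "`P_{1,1}^{[d]} = ∏_{i ∈ [d]} x_i + x₀^d`"), as an element of
`MvPolynomial (Fin (d+1)) k` with `x₀ = X 0` and `x_i = X (Fin.succ (i-1))`.
[cite: DuttaGesmundoIkenmeyerJindalLysikovJSC2025, Sec. 1] -/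
def productPlusPower (d : ℕ) : MvPolynomial (Fin (d + 1)) k :=
  (∏ i : Fin d, X i.succ) + X 0 ^ d

/-- `P^{[d]}_{1,1}` is a form of degree `d`. [folklore] -/
theorem productPlusPower_isHomogeneous (d : ℕ) : (productPlusPower k d).IsHomogeneous d := by
  have h := IsHomogeneous.prod (Finset.univ : Finset (Fin d))
    (fun i => (X i.succ : MvPolynomial (Fin (d + 1)) k)) (fun _ => 1) fun i _ => isHomogeneous_X k _
  simp only [Finset.sum_const, Finset.card_univ, Fintype.card_fin, smul_eq_mul, mul_one] at h
  exact h.add (isHomogeneous_X_pow 0 d)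

/-- The power sum `x₁^n + ⋯ + x_N^n` (Mathlib's `psum`) is a form of degree `n` (private copy of
the lemma in `PowerSumProductObstructions.lean`, to keep the two files independent). [folklore] -/
private theorem psum_isHomogeneous' (σ : Type*) [Fintype σ] (R : Type*) [CommSemiring R] (n : ℕ) :
    (psum σ R n).IsHomogeneous n := by
  rw [psum]
  exact IsHomogeneous.sum _ _ _ fun i _ => isHomogeneous_X_pow i n

/-- DGIJL's partition `λ = (5d-1, 1) + ((d+1) × (10d)) = (15d-1, 10d+1, 10d, …, 10d)` (`d + 1`
parts) of `10d² + 15d = 5d(2d+3)`, for `d ≥ 1` (row-wise sum; `a × b` = `a` rows of length `b`).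
[cite: DuttaGesmundoIkenmeyerJindalLysikovJSC2025, Thm. 4.10] -/
def dgijlPartition (d : ℕ) (hd : 0 < d) : Nat.Partition (5 * d * (2 * d + 3)) :=
  Nat.Partition.ofSums _ ({15 * d - 1, 10 * d + 1} + Multiset.replicate (d - 1) (10 * d)) (by
    obtain ⟨e, rfl⟩ : ∃ e, d = e + 1 := ⟨d - 1, by omega⟩
    have h1 : 15 * (e + 1) - 1 = 15 * e + 14 := by omega
    have h2 : e + 1 - 1 = e := by omega
    simp only [Multiset.insert_eq_cons, Multiset.sum_add, Multiset.sum_cons, Multiset.sum_singleton,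
      Multiset.sum_replicate, smul_eq_mul, h1, h2]
    ring)

/-- NAMED FACT (**Dutta–Gesmundo–Ikenmeyer–Jindal–Lysikov 2025, Thm. 4.10**, arXiv:2211.07055
p. 24; = Thm. 1.4 of the introduction, see the file header on `d` even). "Let `d ≥ 3` be even,
and let `λ := (5d-1,1)+((d+1) × (10d))`. Then …
`mult_λ(ℂ[\overline{GL_{d+1} P^{[d]}_{1,1}}]) ≤ 4 < 5 = mult_λ(ℂ[\overline{GL_{d+1} (x₁^d + ⋯ + x_{d+1}^d)}])`."
Rendered with `orbitMultiplicity` at the dual weight of `λ` (file header).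
[cite: DuttaGesmundoIkenmeyerJindalLysikovJSC2025, Thm. 4.10] -/
def DGIJL2025_thm_4_10 : Prop :=
  ∀ (d : ℕ) (hd : 3 ≤ d), Even d →
    orbitMultiplicity ℂ (productPlusPower ℂ d) d
        (Weight.dualOfPartition (d + 1) (dgijlPartition d (zero_lt_three.trans_le hd))) ≤ 4 ∧
      orbitMultiplicity ℂ (psum (Fin (d + 1)) ℂ d) d
        (Weight.dualOfPartition (d + 1) (dgijlPartition d (zero_lt_three.trans_le hd))) = 5

/-- KERNEL: under Thm. 4.10, `λ` is a multiplicity obstruction against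
`x₀^d + ⋯ + x_d^d ∈ Δ_d[P^{[d]}_{1,1}]` in the sense of `IsMultiplicityObstructionAt`
("we have representation theoretic multiplicity obstructions").
[cite: DuttaGesmundoIkenmeyerJindalLysikovJSC2025, Thm. 4.10] -/
theorem dgijl2025_isMultiplicityObstructionAt (h : DGIJL2025_thm_4_10) {d : ℕ} (hd : 3 ≤ d)
    (he : Even d) :
    IsMultiplicityObstructionAt (productPlusPower ℂ d) (psum (Fin (d + 1)) ℂ d) d
      (Weight.dualOfPartition (d + 1) (dgijlPartition d (zero_lt_three.trans_le hd))) := by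
  obtain ⟨hP, hS⟩ := h d hd he
  unfold IsMultiplicityObstructionAt
  omega

/-- KERNEL: the separation of Thm. 4.10, `x₀^d + ⋯ + x_d^d ∉ Δ_d[P^{[d]}_{1,1}]` for even
`d ≥ 3` ("and hence `\overline{GL_{d+1}(x₁^d + ⋯ + x_{d+1}^d)} ⊄ \overline{GL_{d+1} P^{[d]}_{1,1}}`"),
from the fact and the multiplicity-obstruction principle
`orbitMultiplicity_le_of_mem_orbitClosure`.
[cite: DuttaGesmundoIkenmeyerJindalLysikovJSC2025, Thm. 4.10] -/
theorem dgijl2025_psum_not_mem_orbitClosure (h : DGIJL2025_thm_4_10)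
    (hprin : orbitMultiplicity_le_of_mem_orbitClosure) {d : ℕ} (hd : 3 ≤ d) (he : Even d) :
    psum (Fin (d + 1)) ℂ d ∉ orbitClosure (productPlusPower ℂ d) :=
  not_mem_orbitClosure_of_isMultiplicityObstructionAt hprin (by omega)
    (productPlusPower_isHomogeneous ℂ d) (psum_isHomogeneous' (Fin (d + 1)) ℂ d)
    (dgijl2025_isMultiplicityObstructionAt h hd he)

end Literature.Computability.AlgebraicComplexity
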